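import Mathlib
import HarnessLib
import Summits.NavierStokesRegularity.NavierStokesRegularity.Theorems.TypeILiouvilleShorelinePlanarWallVertical
import Summits.NavierStokesRegularity.NavierStokesRegularity.Theorems.TypeILiouvilleTypeIDoorLocalAxis
import Literature.Analysis.FluidPDE.AncientSimilarityVorticity
import Literature.Analysis.FluidPDE.VorticityCalculus

/-!
# TypeILiouvilleGeneralizedBeltrami — crux (L) stmt-NavierStokesRegularity-10661 `TypeIliouvilleL`:
# GENERALIZED BELTRAMI MEMBERS OF PRINT'S CLASS ARE ONE CONSTANT VECTOR (no side condition)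

Helper for stmt-NavierStokesRegularity-10661 (`--supports`); theorems only, no definitions, no named-fact hypotheses;
closes no item; Navier–Stokes regularity is NOT proved here (leafhand seat of the EulerZoomLiouville route).

Class P = print's class of bounded ancient mild solutions (KNSS 2009 §4 (i); the class of the registered stubs
`stub_quiescentLiouville` (L_Q) and `stub_persistent_mild_backward_L3_recurrence` (S3ᵐ) of the crux):
`v : ℝ → ℝ³ → ℝ³` continuous and bounded on `(−∞,0) × ℝ³`, weakly divergence free on every slice, with
`v(t) = e^{(t−s)Δ}v(s) − B¹_s(v,v)(t)` for `s < t < 0`.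

A GENERALIZED BELTRAMI flow (Truesdell 1954 §52; Majda–Bertozzi 2002 §2.3) is one whose Lamb vector `v × ω`, `ω = curl v`,
is curl-free on every slice, equivalently (`div v = div ω = 0`, `curl_cross_apply`) one whose vortex stretching balances
vorticity advection POINTWISE, `Dv[ω] = Dω[v]`; Beltrami / Trkalian / force-free fields (`ω ∥ v`) and potential flows are
instances.  For such a flow the class-P vorticity equation (`TypeILiouvilleStrainLedger.classP_vorticity_eq`) collapses
to the HEAT EQUATION `∂ₜω = Δω` for the bounded smooth vorticity, so `ω` is one constant vector (`heat_liouville`).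

* §0 `eq_of_curl_eq_const_of_isDivFree_of_bounded` — NEW ENDGAME: a bounded `C²` field on `ℝ³` with CONSTANT curl and
  zero divergence is constant (its finite differences `V(·+h) − V` are curl-free, divergence-free, bounded, hence constant
  by `eq_of_curl_eq_zero_of_isDivFree_of_bounded`; boundedness along `ℕh` kills the increment).  This removes the side
  conditions used so far in the tree to kill the constant vorticity (Type-I rate in
  `LocalLambTubeDoorGeneralisedBeltramiProfileRigidity.eq_zero_of_convect_comm`; tangency `⟪x − x₀, ω⟫ = 0` in
  `PoloidalLiouville.Antidynamo.constant_of_lamb_curlFree`).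
* §1 ★ `classP_const_of_convect_comm` / `classP_const_of_lambCurlFree` — **A NEW PROVED SECTOR OF (L): every
  generalized Beltrami member of class P is ONE CONSTANT VECTOR.**
* §2 `classP_const_of_vorticity_parallel`, `classP_const_of_beltrami`, `classP_zero_of_beltrami_of_ne` — Beltrami /
  Trkalian / force-free members (`ω(t,x) = λ(t,x) v(t,x)`, any scalar function `λ`) are constant, and ZERO as soon as
  `λ ≠ 0` at one point.
* §3 BY NAME on the registered stubs of the (L) skeleton (binders VERBATIM + the stratum hypothesis):
  `quiescentLiouville_onGeneralizedBeltrami` (L_Q), `persistentMild_onGeneralizedBeltrami` (S3ᵐ),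
  `typeIAncientLiouville_onGeneralizedBeltrami` (door stmt-4050 = `stub_typeIAncientLiouville_knssGauge`; independently
  covered in the Type-I class by route LocalLambTubeDoor, here a corollary of §1 by backward shifts).

READING for the residual of (L): a counterexample to (L) in class P has `Dv[ω] ≠ Dω[v]` at SOME point of SOME slice
`t < 0` — its Lamb vector is not curl-free there; the nonlinear vortex dynamics is genuinely active.
HONEST LABEL: a classical sector; nothing here proves a registered stub, (L), or Navier–Stokes regularity; rung 0.
[cite: KochNadirashviliSereginSverak2009, §4 (i), Remark 6.1, proof of Thm 6.2 p. 13 (arXiv:0709.3599)]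
[cite: MajdaBertozziCUP2002, §1.1 (vector identities), §2.3 (Beltrami flows)] [cite: LemarieRieusset2016, Thm. 9.12]
-/

noncomputable section
open MeasureTheory Filter Set Function Metric
open scoped Topology ENNReal RealInnerProductSpace Laplacian ContDiff
open Literature.Analysis Literature.Analysis.FluidPDE Literature.Analysis.UnboundedOperators
set_option linter.dupNamespace false
namespace Summit.NavierStokesRegularity.NavierStokesRegularity.Theorems.TypeILiouvilleGeneralizedBeltrami

/-! ## §0 The endgame: constant curl + zero divergence + bounded ⟹ constant -/

/-- **A bounded `C²` vector field on `ℝ³` with constant curl and vanishing divergence is constant.**  For every `h`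
the finite difference `W = V(· + h) − V` is `C²`, curl-free, divergence-free and bounded, hence constant
(`eq_of_curl_eq_zero_of_isDivFree_of_bounded`): `V(x + h) − V(x) = V(h) − V(0) =: d(h)`.  Then
`V(n•h) = V(0) + n•d(h)` for all `n : ℕ`, and `‖n•d(h)‖ ≤ 2M` forces `d(h) = 0`. [folklore]
[cite: KochNadirashviliSereginSverak2009, Lemma 3.1 (arXiv:0709.3599 p. 7)] -/
theorem eq_of_curl_eq_const_of_isDivFree_of_bounded
    {V : EuclideanSpace ℝ (Fin 3) → EuclideanSpace ℝ (Fin 3)} (hV : ContDiff ℝ 2 V)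
    {c : EuclideanSpace ℝ (Fin 3)} (hcurl : ∀ x, curl V x = c) (hdiv : VectorCalculus.IsDivFree V)
    {M : ℝ} (hM : ∀ x, ‖V x‖ ≤ M) (x y : EuclideanSpace ℝ (Fin 3)) : V x = V y := by
  have hdV : Differentiable ℝ V := hV.differentiable two_ne_zero
  -- finite differences are constant
  have hshift : ∀ h z : EuclideanSpace ℝ (Fin 3), V (z + h) - V z = V h - V 0 := by
    intro h z
    set W : EuclideanSpace ℝ (Fin 3) → EuclideanSpace ℝ (Fin 3) := fun z => V (z + h) - V z with hW
    have hW2 : ContDiff ℝ 2 W := (hV.comp (contDiff_id.add contDiff_const)).sub hV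
    have hfd : ∀ z, fderiv ℝ W z = fderiv ℝ V (z + h) - fderiv ℝ V z := by
      intro z
      have h1 : DifferentiableAt ℝ (fun z => V (z + h)) z :=
        (hdV (z + h)).comp z (differentiableAt_id.add (differentiableAt_const h))
      rw [hW, fderiv_fun_sub h1 (hdV z), fderiv_comp_add_right]
    have hWcurl : ∀ z, curl W z = 0 := by
      intro z
      rw [curl_eq_curlCLM, hfd z, map_sub, ← curl_eq_curlCLM, ← curl_eq_curlCLM, hcurl, hcurl, sub_self]
    have hWdiv : VectorCalculus.IsDivFree W := by
      intro z
      have h1 := hdiv (z + h)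
      have h2 := hdiv z
      rw [VectorCalculus.divergence] at h1 h2 ⊢
      have hco : ((fderiv ℝ W z : EuclideanSpace ℝ (Fin 3) →L[ℝ] EuclideanSpace ℝ (Fin 3)) :
            EuclideanSpace ℝ (Fin 3) →ₗ[ℝ] EuclideanSpace ℝ (Fin 3)) =
          (fderiv ℝ V (z + h) : EuclideanSpace ℝ (Fin 3) →ₗ[ℝ] EuclideanSpace ℝ (Fin 3)) -
            (fderiv ℝ V z : EuclideanSpace ℝ (Fin 3) →ₗ[ℝ] EuclideanSpace ℝ (Fin 3)) := by
        rw [hfd z]; rfl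
      rw [hco, map_sub, h1, h2, sub_zero]
    have hWbd : ∀ z, ‖W z‖ ≤ M + M := fun z => (norm_sub_le _ _).trans (add_le_add (hM _) (hM _))
    have key := eq_of_curl_eq_zero_of_isDivFree_of_bounded hW2 hWcurl hWdiv hWbd z 0
    simpa [hW] using key
  -- iterate along `ℕ h`
  have hiter : ∀ (h : EuclideanSpace ℝ (Fin 3)) (n : ℕ), V ((n : ℝ) • h) = V 0 + (n : ℝ) • (V h - V 0) := by
    intro h n
    induction n with
    | zero => simp
    | succ n ih =>
      have e : ((n + 1 : ℕ) : ℝ) • h = (n : ℝ) • h + h := by rw [Nat.cast_succ, add_smul, one_smul]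
      have h1 : V ((n : ℝ) • h + h) = V ((n : ℝ) • h) + (V h - V 0) := by
        rw [← hshift h ((n : ℝ) • h)]; abel
      rw [e, h1, ih, Nat.cast_succ, add_smul, one_smul]
      abel
  -- boundedness kills the increment
  have hzero : ∀ h : EuclideanSpace ℝ (Fin 3), V h - V 0 = 0 := by
    intro h
    by_contra hne
    have hpos : 0 < ‖V h - V 0‖ := norm_pos_iff.2 hne
    obtain ⟨n, hn⟩ := exists_nat_gt ((M + M) / ‖V h - V 0‖)
    have h1 : ‖(n : ℝ) • (V h - V 0)‖ ≤ M + M := by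
      have e : (n : ℝ) • (V h - V 0) = V ((n : ℝ) • h) - V 0 := by rw [hiter h n]; abel
      rw [e]
      exact (norm_sub_le _ _).trans (add_le_add (hM _) (hM _))
    rw [norm_smul, Real.norm_natCast] at h1
    have h2 : M + M < (n : ℝ) * ‖V h - V 0‖ := (div_lt_iff₀ hpos).1 hn
    linarith
  have h := hshift (y - x) x
  rw [hzero, sub_eq_zero, add_sub_cancel] at h
  exact h.symm

/-! ## §1 ★ Generalized Beltrami members of class P are constant -/

/-- ★ **COMMUTATOR FORM.  A class-P flow whose vortex stretching balances vorticity advection pointwise,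
`Dv(t)(x)[curl v(t)(x)] = D(curl v(t))(x)[v(t)(x)]` on `(−∞,0) × ℝ³` (the vector fields `v(t)` and `curl v(t)`
commute), is ONE CONSTANT VECTOR.**  Proof: by the class-P vorticity equation the bounded smooth vorticity solves
`∂ₜω = Δω` on the open past slab, so it is one constant vector (`heat_liouville`); a slice with constant curl is
constant (§0); the slice constants agree (KNSS Remark 6.1).
[cite: KochNadirashviliSereginSverak2009, §4 (i), Remark 6.1, proof of Thm 6.2 p. 13 (arXiv:0709.3599)] -/
theorem classP_const_of_convect_comm
    {v : ℝ → EuclideanSpace ℝ (Fin 3) → EuclideanSpace ℝ (Fin 3)}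
    (hc : ContinuousOn (uncurry v) (Iio 0 ×ˢ univ))
    (hK : ∃ K : ℝ, ∀ t < 0, ∀ x, ‖v t x‖ ≤ K)
    (hd : ∀ t < 0, IsWeaklyDivFree (v t))
    (hm : ∀ s t : ℝ, s < t → t < 0 → ∀ x,
      v t x = heatExtension (v s) (t - s) x - oseenDuhamel 1 s v v t x)
    (hcomm : ∀ t < 0, ∀ x, fderiv ℝ (v t) x (curl (v t) x) = fderiv ℝ (curl (v t)) x (v t x)) :
    ∃ b : EuclideanSpace ℝ (Fin 3), ∀ t < 0, ∀ x, v t x = b := by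
  obtain ⟨K, hKb⟩ := hK
  obtain ⟨hsm', hbounds⟩ := smooth_and_bounds_of_bounded_ancient_oseenMild hc hd hm hKb
  have hsm : IsSmoothSpaceTimeOn (Iio 0) v := hsm'
  have hvort : IsSmoothSpaceTimeOn (Iio 0) (vorticity v) := isSmoothSpaceTimeOn_vorticity_Iio hsm
  have hslice : ∀ t < 0, ContDiff ℝ 2 (v t) := fun t ht =>
    (hsm.contDiff_slice (mem_Iio.2 ht)).of_le (by norm_cast)
  obtain ⟨C₁, hC₁⟩ := hbounds 1
  have hωbd : ∀ τ < 0, ∀ y, ‖curl (v τ) y‖ ≤ ‖curlCLM‖ * C₁ := by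
    intro τ hτ y
    have h1 : ‖fderiv ℝ (v τ) y‖ ≤ C₁ := by
      have := hC₁ τ hτ y; rwa [norm_iteratedFDeriv_one] at this
    calc ‖curl (v τ) y‖ = ‖curlCLM (fderiv ℝ (v τ) y)‖ := rfl
      _ ≤ ‖curlCLM‖ * ‖fderiv ℝ (v τ) y‖ := ContinuousLinearMap.le_opNorm _ _
      _ ≤ ‖curlCLM‖ * C₁ := mul_le_mul_of_nonneg_left h1 (norm_nonneg curlCLM)
  -- the vorticity equation collapses to the heat equation
  have hlaw : ∀ t < 0, ∀ x, deriv (fun s => curl (v s) x) t = (Δ (curl (v t))) x := by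
    intro t ht x
    have h := TypeILiouvilleStrainLedger.classP_vorticity_eq hc ⟨K, hKb⟩ hd hm ht x
    rw [hcomm t ht x] at h
    exact add_right_cancel (h.trans (add_comm _ _))
  have hO : IsOpen (Iio (0 : ℝ) ×ˢ (univ : Set (EuclideanSpace ℝ (Fin 3)))) := isOpen_Iio.prod isOpen_univ
  have hωinf : ContDiffOn ℝ ∞ (uncurry (vorticity v)) (Iio (0 : ℝ) ×ˢ univ) := hvort
  have hω2 : ContDiffOn ℝ 2 (uncurry (vorticity v)) (Iio (0 : ℝ) ×ˢ univ) := hωinf.of_le (by norm_cast)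
  have hheat : ∀ z ∈ Iio (0 : ℝ) ×ˢ (univ : Set (EuclideanSpace ℝ (Fin 3))),
      Carleman.dt (uncurry (vorticity v)) z = Carleman.lap (uncurry (vorticity v)) z := by
    rintro ⟨t, y⟩ hz
    have ht : t < 0 := (mem_prod.1 hz).1
    have hdω : DifferentiableAt ℝ (uncurry (vorticity v)) (t, y) :=
      (hω2.differentiableOn (by norm_num)).differentiableAt (hO.mem_nhds hz)
    rw [Carleman.dt_uncurry hdω, Literature.Analysis.FluidPDE.timeDeriv_apply, Carleman.lap_uncurry hO hz hω2]
    have hfun : (fun s => vorticity v s y) = fun s => curl (v s) y := by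
      funext s; simp [vorticity_apply]
    rw [hfun, hlaw t ht y, vorticity_apply]
  -- heat Liouville: the vorticity is one constant vector
  have key : ∀ t t' : ℝ, t < 0 → t' < 0 → ∀ y y' : EuclideanSpace ℝ (Fin 3), curl (v t) y = curl (v t') y' := by
    intro t t' ht ht' y y'
    have h := Literature.Analysis.PDE.heat_liouville (u := uncurry (vorticity v)) (T := 0) (A := ‖curlCLM‖ * C₁)
      (γ := 0) le_rfl zero_lt_one hω2 hheat ?_ (z := (t, y)) (w := (t', y')) (mem_prod.2 ⟨ht, mem_univ _⟩)
      (mem_prod.2 ⟨ht', mem_univ _⟩)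
    · simpa [vorticity_apply] using h
    · rintro ⟨τ, z⟩ hz
      have hτ : τ < 0 := (mem_prod.1 hz).1
      rw [Real.rpow_zero, mul_one]
      simpa [vorticity_apply] using hωbd τ hτ z
  -- constant curl on a slice ⟹ the slice is constant (§0)
  have hdiv' : ∀ t < 0, VectorCalculus.IsDivFree (v t) := fun t ht =>
    (hd t ht).isDivFree_of_contDiff ((hslice t ht).of_le (by norm_num))
  have hub : ∀ t < 0, ∀ x, v t x = v t 0 := fun t ht x =>
    eq_of_curl_eq_const_of_isDivFree_of_bounded (hslice t ht) (c := curl (v t) 0)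
      (fun z => key t t ht ht z 0) (hdiv' t ht) (fun z => hKb t ht z) x 0
  -- the slice constants agree (KNSS Remark 6.1)
  have hmild1 : ∀ s t : ℝ, s < t → t < 0 → ∀ᵐ x ∂(volume : Measure (EuclideanSpace ℝ (Fin 3))),
      v t x = heatExtension (v s) (1 * (t - s)) x - oseenDuhamel 1 s v v t x :=
    fun s t hst ht => Eventually.of_forall fun x => by rw [one_mul]; exact hm s t hst ht x
  have htime := KNSS2009_remark61 one_pos (b := fun t => v t 0) hub hmild1
  exact ⟨v (-1) 0, fun t ht x => by rw [hub t ht x]; exact htime t (-1) ht (by norm_num)⟩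

/-- On class P the commutator condition is the generalized Beltrami condition: for a `C²` divergence-free slice,
`curl (v × curl v) = Dv[curl v] − D(curl v)[v]` (`curl_cross_apply`, `div v = div curl v = 0`).
[cite: MajdaBertozziCUP2002, §1.1 (vector identities)] -/
theorem curl_lamb_eq_sub {w : EuclideanSpace ℝ (Fin 3) → EuclideanSpace ℝ (Fin 3)} (hw : ContDiff ℝ 2 w)
    (hdiv : VectorCalculus.IsDivFree w) (x : EuclideanSpace ℝ (Fin 3)) :
    curl (fun y => cross (w y) (curl w y)) x = fderiv ℝ w x (curl w x) - fderiv ℝ (curl w) x (w x) := by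
  have hω1 : ContDiff ℝ 1 (curl w) := contDiff_curl (n := 1) (by exact_mod_cast hw)
  have dω : DifferentiableAt ℝ (curl w) x := (hω1.differentiable one_ne_zero) x
  have dw : DifferentiableAt ℝ w x := (hw.differentiable two_ne_zero) x
  rw [curl_cross_apply dw dω, hdiv x, divergence_curl_eq_zero_holds w hw x, zero_smul, zero_smul, sub_zero,
    add_zero]

/-- ★ **LAMB-VECTOR FORM — GENERALIZED BELTRAMI MEMBERS OF CLASS P ARE ONE CONSTANT VECTOR.**  A class-P flow whose
Lamb vector `v(t) × curl v(t)` is curl-free on every slice `t < 0` is one constant vector.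
[cite: KochNadirashviliSereginSverak2009, §4 (i), Remark 6.1 (arXiv:0709.3599)] [cite: MajdaBertozziCUP2002, §2.3] -/
theorem classP_const_of_lambCurlFree
    {v : ℝ → EuclideanSpace ℝ (Fin 3) → EuclideanSpace ℝ (Fin 3)}
    (hc : ContinuousOn (uncurry v) (Iio 0 ×ˢ univ))
    (hK : ∃ K : ℝ, ∀ t < 0, ∀ x, ‖v t x‖ ≤ K)
    (hd : ∀ t < 0, IsWeaklyDivFree (v t))
    (hm : ∀ s t : ℝ, s < t → t < 0 → ∀ x,
      v t x = heatExtension (v s) (t - s) x - oseenDuhamel 1 s v v t x)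
    (hlamb : ∀ t < 0, ∀ x, curl (fun y => cross (v t y) (curl (v t) y)) x = 0) :
    ∃ b : EuclideanSpace ℝ (Fin 3), ∀ t < 0, ∀ x, v t x = b := by
  obtain ⟨K, hKb⟩ := hK
  obtain ⟨hsm', -⟩ := smooth_and_bounds_of_bounded_ancient_oseenMild hc hd hm hKb
  have hsm : IsSmoothSpaceTimeOn (Iio 0) v := hsm'
  have hslice : ∀ t < 0, ContDiff ℝ 2 (v t) := fun t ht =>
    (hsm.contDiff_slice (mem_Iio.2 ht)).of_le (by norm_cast)
  have hdiv' : ∀ t < 0, VectorCalculus.IsDivFree (v t) := fun t ht =>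
    (hd t ht).isDivFree_of_contDiff ((hslice t ht).of_le (by norm_num))
  refine classP_const_of_convect_comm hc ⟨K, hKb⟩ hd hm fun t ht x => ?_
  have h := curl_lamb_eq_sub (hslice t ht) (hdiv' t ht) x
  rw [hlamb t ht x] at h
  exact (sub_eq_zero.1 h.symm)

/-! ## §2 Beltrami / Trkalian / force-free members -/

/-- **VORTICITY EVERYWHERE PARALLEL TO VELOCITY ⟹ CONSTANT.**  A class-P flow with `v(t,x) × curl v(t)(x) = 0` on
`(−∞,0) × ℝ³` (zero Lamb vector: the force-free / Beltrami members in the widest pointwise sense) is one constant vector.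
[cite: MajdaBertozziCUP2002, §2.3 (Beltrami flows)] [cite: KochNadirashviliSereginSverak2009, §4 (i) (arXiv:0709.3599)] -/
theorem classP_const_of_vorticity_parallel
    {v : ℝ → EuclideanSpace ℝ (Fin 3) → EuclideanSpace ℝ (Fin 3)}
    (hc : ContinuousOn (uncurry v) (Iio 0 ×ˢ univ))
    (hK : ∃ K : ℝ, ∀ t < 0, ∀ x, ‖v t x‖ ≤ K)
    (hd : ∀ t < 0, IsWeaklyDivFree (v t))
    (hm : ∀ s t : ℝ, s < t → t < 0 → ∀ x,
      v t x = heatExtension (v s) (t - s) x - oseenDuhamel 1 s v v t x)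
    (hpar : ∀ t < 0, ∀ x, cross (v t x) (curl (v t) x) = 0) :
    ∃ b : EuclideanSpace ℝ (Fin 3), ∀ t < 0, ∀ x, v t x = b := by
  refine classP_const_of_lambCurlFree hc hK hd hm fun t ht x => ?_
  have hfun : (fun y => cross (v t y) (curl (v t) y)) = fun _ => (0 : EuclideanSpace ℝ (Fin 3)) :=
    funext (hpar t ht)
  rw [hfun, curl_eq_curlCLM, fderiv_const_apply, map_zero]

/-- **BELTRAMI (TRKALIAN, FORCE-FREE) MEMBERS ARE CONSTANT**: `curl v(t)(x) = λ(t,x) • v(t,x)` for an arbitrary scalar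
function `λ` ⟹ one constant vector. [cite: MajdaBertozziCUP2002, §2.3 (Beltrami flows)] -/
theorem classP_const_of_beltrami
    {v : ℝ → EuclideanSpace ℝ (Fin 3) → EuclideanSpace ℝ (Fin 3)}
    (hc : ContinuousOn (uncurry v) (Iio 0 ×ˢ univ))
    (hK : ∃ K : ℝ, ∀ t < 0, ∀ x, ‖v t x‖ ≤ K)
    (hd : ∀ t < 0, IsWeaklyDivFree (v t))
    (hm : ∀ s t : ℝ, s < t → t < 0 → ∀ x,
      v t x = heatExtension (v s) (t - s) x - oseenDuhamel 1 s v v t x)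
    (lam : ℝ → EuclideanSpace ℝ (Fin 3) → ℝ) (hbel : ∀ t < 0, ∀ x, curl (v t) x = lam t x • v t x) :
    ∃ b : EuclideanSpace ℝ (Fin 3), ∀ t < 0, ∀ x, v t x = b :=
  classP_const_of_vorticity_parallel hc hK hd hm fun t ht x => by rw [hbel t ht x]; simp [cross, cross_self]

/-- **… AND ZERO AS SOON AS THE PROPORTIONALITY FACTOR IS NON-ZERO AT ONE POINT**: the flow is a constant `b`, so
`curl v ≡ 0 = λ(t₀,x₀) • b` with `λ(t₀,x₀) ≠ 0` forces `b = 0`. [cite: MajdaBertozziCUP2002, §2.3 (Beltrami flows)] -/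
theorem classP_zero_of_beltrami_of_ne
    {v : ℝ → EuclideanSpace ℝ (Fin 3) → EuclideanSpace ℝ (Fin 3)}
    (hc : ContinuousOn (uncurry v) (Iio 0 ×ˢ univ))
    (hK : ∃ K : ℝ, ∀ t < 0, ∀ x, ‖v t x‖ ≤ K)
    (hd : ∀ t < 0, IsWeaklyDivFree (v t))
    (hm : ∀ s t : ℝ, s < t → t < 0 → ∀ x,
      v t x = heatExtension (v s) (t - s) x - oseenDuhamel 1 s v v t x)
    (lam : ℝ → EuclideanSpace ℝ (Fin 3) → ℝ) (hbel : ∀ t < 0, ∀ x, curl (v t) x = lam t x • v t x)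
    {t₀ : ℝ} (ht₀ : t₀ < 0) {x₀ : EuclideanSpace ℝ (Fin 3)} (hne : lam t₀ x₀ ≠ 0) :
    ∀ t < 0, ∀ x, v t x = 0 := by
  obtain ⟨b, hb⟩ := classP_const_of_beltrami hc hK hd hm lam hbel
  have hvt₀ : v t₀ = fun _ => b := funext (hb t₀ ht₀)
  have hcurl : curl (v t₀) x₀ = 0 := by
    rw [hvt₀, curl_eq_curlCLM, fderiv_const_apply, map_zero]
  rw [hbel t₀ ht₀ x₀, hb t₀ ht₀ x₀, smul_eq_zero] at hcurl
  have hb0 : b = 0 := hcurl.resolve_left hne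
  intro t ht x
  rw [hb t ht x, hb0]

/-! ## §3 By name on the registered stubs of the (L) skeleton (binders verbatim + the stratum) -/

/-- **L_Q (registered `stub_quiescentLiouville`) HOLDS on the generalized Beltrami stratum** — binders of the stub
verbatim plus `curl (v(t) × curl v(t)) ≡ 0`; the quiescence hypothesis is not used.
[cite: KochNadirashviliSereginSverak2009, §4 (i), Remark 6.1 (arXiv:0709.3599)] -/
theorem quiescentLiouville_onGeneralizedBeltrami :
    ∀ v : ℝ → EuclideanSpace ℝ (Fin 3) → EuclideanSpace ℝ (Fin 3),
      ContinuousOn (Function.uncurry v) (Set.Iio 0 ×ˢ Set.univ) →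
      (∃ K : ℝ, ∀ t < 0, ∀ x, ‖v t x‖ ≤ K) →
      (∀ t < 0, Literature.Analysis.FluidPDE.IsWeaklyDivFree (v t)) →
      (∀ s t : ℝ, s < t → t < 0 → ∀ x,
        v t x = Literature.Analysis.UnboundedOperators.heatExtension (v s) (t - s) x -
          Literature.Analysis.FluidPDE.oseenDuhamel 1 s v v t x) →
      (∀ ε : ℝ, 0 < ε → ∃ T : ℝ, T < 0 ∧ ∀ t < T, ∀ x y : EuclideanSpace ℝ (Fin 3),
        dist x y ≤ 1 → ‖v t x - v t y‖ ≤ ε) →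
      (∀ t < 0, ∀ x, curl (fun y => cross (v t y) (curl (v t) y)) x = 0) →
      ∃ b : EuclideanSpace ℝ (Fin 3), ∀ t < 0, ∀ x, v t x = b := by
  intro v hc hK hd hm _ hlamb
  exact classP_const_of_lambCurlFree hc hK hd hm hlamb

/-- **S3ᵐ (registered `stub_persistent_mild_backward_L3_recurrence`) HOLDS on the generalized Beltrami stratum**: the
flow is one constant `b`, so `v(τ_k) − b ≡ 0` has `L³` norm `0 ≤ M` along `τ_k = −(k+1)`; persistence is not used.
[cite: KochNadirashviliSereginSverak2009, §4 (i), Remark 6.1 (arXiv:0709.3599)] -/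
theorem persistentMild_onGeneralizedBeltrami :
    ∀ v : ℝ → EuclideanSpace ℝ (Fin 3) → EuclideanSpace ℝ (Fin 3),
      ContinuousOn (uncurry v) (Iio 0 ×ˢ univ) →
      (∃ K : ℝ, ∀ t < 0, ∀ x, ‖v t x‖ ≤ K) →
      (∀ t < 0, Literature.Analysis.FluidPDE.IsWeaklyDivFree (v t)) →
      (∀ s t : ℝ, s < t → t < 0 → ∀ x,
        v t x = Literature.Analysis.UnboundedOperators.heatExtension (v s) (t - s) x -
          Literature.Analysis.FluidPDE.oseenDuhamel 1 s v v t x) →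
      (¬ ∃ C : ℝ, ∀ t < 0, ∀ x, ‖v t x‖ ≤ C / Real.sqrt (-t)) →
      (∀ t < 0, ∀ x, curl (fun y => cross (v t y) (curl (v t) y)) x = 0) →
      ∃ (b : ℕ → EuclideanSpace ℝ (Fin 3)) (τ : ℕ → ℝ) (M : NNReal),
        (∀ k, τ k < 0) ∧ Tendsto τ atTop atBot ∧
        ∀ k, eLpNorm (fun x => v (τ k) x - b k) 3
          (volume : Measure (EuclideanSpace ℝ (Fin 3))) ≤ (M : ENNReal) := by
  intro v hc hK hd hm _ hlamb
  obtain ⟨b, hb⟩ := classP_const_of_lambCurlFree hc hK hd hm hlamb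
  have hneg : ∀ k : ℕ, -((k : ℝ) + 1) < 0 := fun k => by
    have : (0 : ℝ) < (k : ℝ) + 1 := by positivity
    linarith
  refine ⟨fun _ => b, fun k => -((k : ℝ) + 1), 0, hneg, ?_, fun k => ?_⟩
  · exact tendsto_neg_atTop_atBot.comp
      (tendsto_atTop_add_const_right _ _ tendsto_natCast_atTop_atTop)
  · have hzero : (fun x => v (-((k : ℝ) + 1)) x - b) = fun _ => 0 := by
      funext x; rw [hb _ (hneg k) x, sub_self]
    rw [hzero, eLpNorm_zero']
    exact bot_le

/-- **A KNSS-gauge Type-I ancient mild field which is generalized Beltrami vanishes identically**: each backward shift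
`W(· − δ)` (`δ > 0`) is a generalized Beltrami member of class P, hence one constant `b_δ` (§1); `‖b_δ‖ ≤ C/√(−t)`
for `t < −δ` forces `b_δ = 0`.  (Independently known in the Type-I class: route LocalLambTubeDoor,
`LocalLambTubeDoorGeneralisedBeltramiProfileRigidity.eq_zero_of_convect_comm`; here a corollary of the class-P theorem.)
[cite: KochNadirashviliSereginSverak2009, §4 (i) p. 8 and (1.4) (arXiv:0709.3599)] -/
theorem typeI_eq_zero_of_lambCurlFree {C : ℝ}
    {W : ℝ → EuclideanSpace ℝ (Fin 3) → EuclideanSpace ℝ (Fin 3)} (hW : IsTypeIAncientMild C W)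
    (hlamb : ∀ t < 0, ∀ x, curl (fun y => cross (W t y) (curl (W t) y)) x = 0) :
    ∀ t < 0, ∀ x, W t x = 0 := by
  have hshift : ∀ δ : ℝ, 0 < δ → ∃ b : EuclideanSpace ℝ (Fin 3), ∀ t < 0, ∀ x, W (t - δ) x = b := by
    intro δ hδ
    obtain ⟨hc, hK, hm⟩ := TypeILiouvilleTypeIDoorLocalAxis.typeI_shift_classP hW hδ
    have hsm : ContDiffOn ℝ (⊤ : ℕ∞) (uncurry W) (Iio 0 ×ˢ univ) := hW.1
    have hd : ∀ t < 0, IsWeaklyDivFree ((fun t x => W (t - δ) x) t) := by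
      intro t ht
      have ht' : t - δ < 0 := by linarith
      have hslice : ContDiff ℝ (⊤ : ℕ∞) (W (t - δ)) := by
        have hι : ContDiff ℝ (⊤ : ℕ∞)
            (fun x : EuclideanSpace ℝ (Fin 3) => ((t - δ, x) : ℝ × EuclideanSpace ℝ (Fin 3))) :=
          contDiff_const.prodMk contDiff_id
        exact hsm.comp_contDiff hι fun x => ⟨ht', mem_univ _⟩
      exact VectorCalculus.IsDivFree.isWeaklyDivFree_holds (hW.2.1 _ ht')
        (hslice.of_le (by exact_mod_cast le_top))
    have hl : ∀ t < 0, ∀ x, curl (fun y => cross ((fun t x => W (t - δ) x) t y)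
        (curl ((fun t x => W (t - δ) x) t) y)) x = 0 := fun t ht x => hlamb (t - δ) (by linarith) x
    exact classP_const_of_lambCurlFree hc hK hd hm hl
  have hlim : Tendsto (fun t : ℝ => C / Real.sqrt (-t)) atBot (𝓝 0) :=
    tendsto_const_nhds.div_atTop (Real.tendsto_sqrt_atTop.comp tendsto_neg_atBot_atTop)
  intro t ht x
  obtain ⟨b, hb⟩ := hshift (-t / 2) (by linarith)
  have hb' : ∀ s < -(-t / 2), ∀ y, W s y = b := fun s hs y => by
    have := hb (s + -t / 2) (by linarith) y; rwa [add_sub_cancel_right] at this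
  have hnorm : ∀ᶠ s in atBot, ‖b‖ ≤ C / Real.sqrt (-s) := by
    filter_upwards [eventually_lt_atBot (-(-t / 2))] with s hs
    rw [← hb' s hs 0]; exact hW.norm_le (by linarith) 0
  have hb0 : b = 0 := norm_le_zero_iff.1 (ge_of_tendsto hlim hnorm)
  rw [hb' t (by linarith) x, hb0]

/-- **The Type-I door on the generalized Beltrami stratum, binders VERBATIM** (`Theses.SymmetryModuliCount.TypeIAncientLiouville`,
stmt-4050 = `stub_typeIAncientLiouville_knssGauge` of the (L) skeleton): a smooth, divergence-free, Oseen-kernel-mild,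
Type-I-in-time field on `(−∞,0) × ℝ³` whose Lamb vector is curl-free on every slice vanishes identically.
[cite: KochNadirashviliSereginSverak2009, §4 (i) p. 8 and (1.4) (arXiv:0709.3599)] -/
theorem typeIAncientLiouville_onGeneralizedBeltrami :
    ∀ (C : ℝ) (u : ℝ → EuclideanSpace ℝ (Fin 3) → EuclideanSpace ℝ (Fin 3)),
      ContDiffOn ℝ (⊤ : ℕ∞) (Function.uncurry u) (Set.Iio 0 ×ˢ Set.univ) ∧
      (∀ t < 0, Literature.Analysis.FluidPDE.VectorCalculus.IsDivFree (u t)) ∧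
      (∀ s t : ℝ, s < t → t < 0 → ∀ x,
        u t x = Literature.Analysis.FluidPDE.heatFlow (u s) (t - s) x -
          ∫ τ in Set.Ioo s t, ∫ y,
            Literature.Analysis.FluidPDE.oseenKernel (t - τ) (x - y) (u τ y) (u τ y)) ∧
      Literature.Analysis.FluidPDE.HasTypeITimeDecay C u →
      (∀ t < 0, ∀ x, curl (fun y => cross (u t y) (curl (u t) y)) x = 0) →
      ∀ t < 0, ∀ x, u t x = 0 := by
  intro C u hu hlamb
  exact typeI_eq_zero_of_lambCurlFree (isTypeIAncientMild_iff.2 hu) hlamb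

end Summit.NavierStokesRegularity.NavierStokesRegularity.Theorems.TypeILiouvilleGeneralizedBeltrami

end
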